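import Summits.Ventures.YMGap.RobustBall.MassGapOnBallZdGRowsSUN
import HarnessLib

/-!
# Venture YMGap, track ROBUST-BALL (Y2) — crux Y2-X2-Zd, step 9: HYPOTHESIS-FREE `SU(N)` / `SU(3)`, `d = 3` ROWS of the
# infinite-volume `ℤ³` mass gap on the gauge-invariant ball, and UP-TO forms of the headline cells

HONEST FRAMING. WHAT THIS IS: a venture file (cell `pub-ymgap`, track Y2 ROBUST-BALL, seat ds-2): NUMERIC ROWS of
`massGapOnBallZdG_of_robustStar` (`RobustStarDoorZd.lean`) for `d = 3` on p2's eigen modulus (every `N ≥ 2`,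
HYPOTHESIS-FREE; `SU(3)` certificates VERBATIM from `TorusRowsSU3Star.lean`) — the INFINITE-VOLUME `ℤ³` companions
(unique DLR state + Shen–Zhu–Zhu clustering, `PerturbedMassGapAt`) of Y4's torus receiving rows: schema
`suN_massGapOnBallZdG_dim3_star_eigen` ('t Hooft `β_W/N²`), `SU(3)` cells `(β_W, ε) = (1/4, 53/500), (3/10, 9/125),
(1/3, 1/20)`; plus UP-TO forms (every `0 ≤ β_W ≤ β_W⋆` on the cell's ball; the certificates are monotone in `β_W`)
of the headline cells: `SU(3)`, `d = 4` up to `1/4`; `SU(2)`, `d = 3` up to `1/2`; `SU(3)`, `d = 3` up to `1/3`.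
WHAT THIS IS NOT: every radius is an artefact of the door; strong-coupling LATTICE statements — nothing about the
continuum limit or the Millennium problem; tier 2 is not touched.

## References
* The tree: `RobustBall/RobustStarDoorZd.lean`, `RobustBall/MassGapOnBallZdGRowsSUN.lean` (ds-2),
  `RobustBall/TorusRowsSU3Star.lean` (g7 certificates), `Thresholds/OneLinkEigenModulus.lean` (p2).
-/

noncomputable section

open Literature.MathematicalPhysics.QuantumFieldTheory.Balaban1983to89.StrongCouplingDobrushinWindow
  (OneLinkKRModulus)
open Summit.Ventures.YMGap.StarResolventDim (Delta gaugeR doorPoly gaugeR_lt_one_of_door)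

namespace Summit.Ventures.YMGap.RobustBall

/-! ### `SU(N)`, `d = 3`: the hypothesis-free schema on the eigen modulus -/

/-- **SCHEMA, `SU(N)` (`N ≥ 2`), `d = 3`, HYPOTHESIS-FREE: the mass gap on the whole gauge-invariant tier-1 `ℤ³` ball
`MemBallZdG ε₀ ε₁ R` at 't Hooft coupling `β_W/N²` (tree coupling `β_W/N`) through the ROBUST STAR DOOR on p2's eigen
modulus** at radius `4β_W/N² < 1/2` (door `doorPoly 3 c < 1`, `θ = 4c + λ`, `gaugeR 3 c + (λ + θ^K·12λ)/(1−θ) < 1`):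
`MassGapOnBallZdG 3 N (β_W/N²) ε₀ ε₁ R`. [folklore] -/
theorem suN_massGapOnBallZdG_dim3_star_eigen (Kn : ℕ) {N : ℕ} (hN : 2 ≤ N) {βW ε₀ ε₁ c lam E S Kb : ℝ}
    (hβ0 : 0 ≤ βW) (hR : βW / (N : ℝ) ^ 2 * 4 < 1 / 2) (hε₁ : 0 ≤ ε₁) (hE : Real.exp ε₀ ≤ E)
    (hS : Real.sqrt N ≤ S) (hKb : (N : ℝ) ^ 2 / ((N : ℝ) ^ 2 - 1) * ((1 / 2 + 2 * (βW / (N : ℝ) ^ 2 * 4)) /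
      (1 / 2 - βW / (N : ℝ) ^ 2 * 4)) ≤ Kb)
    (hc : Kb * E * (1 + 2 * S * ε₁) * (βW / (N : ℝ) ^ 2) ≤ c) (hlam : S * ε₁ ≤ lam) (hθ1 : 4 * c + lam < 1)
    (hcd : doorPoly 3 c < 1) (hρ1 : gaugeR 3 c + (lam + (4 * c + lam) ^ Kn * (12 * lam)) / (1 - (4 * c + lam)) < 1)
    (R : ℕ) : MassGapOnBallZdG 3 N (βW / (N : ℝ) ^ 2) ε₀ ε₁ R := by
  have hN1 : 1 ≤ N := by omega
  have hNpos : (0 : ℝ) < N := by exact_mod_cast (show 0 < N by omega)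
  have hN2 : (2 : ℝ) ≤ N := by exact_mod_cast hN
  set Rm : ℝ := βW / (N : ℝ) ^ 2 * 4 with hRdef
  set K : ℝ := (N : ℝ) ^ 2 / ((N : ℝ) ^ 2 - 1) * ((1 / 2 + 2 * Rm) / (1 / 2 - Rm)) with hKdef
  have hmod : OneLinkKRModulus N Rm K := OneLinkEigen.oneLinkKRModulus_eigen hN hR
  have hK0 : 0 ≤ K := by
    have h1 : (0 : ℝ) < (N : ℝ) ^ 2 - 1 := by nlinarith
    have h2 : (0 : ℝ) < 1 / 2 - Rm := by linarith
    positivity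
  have hS0 : 0 ≤ S := (Real.sqrt_nonneg _).trans hS
  have hE0 : 0 ≤ E := (Real.exp_pos _).le.trans hE
  have hKb0 : 0 ≤ Kb := hK0.trans hKb
  set θ : ℝ := 4 * c + lam with hθ
  set ρ : ℝ := gaugeR 3 c + (lam + θ ^ Kn * (12 * lam)) / (1 - θ) with hρ
  have habs : |(N : ℝ) * (βW / (N : ℝ) ^ 2)| / (N : ℝ) = βW / (N : ℝ) ^ 2 := by
    rw [abs_of_nonneg (by positivity)]
    field_simp
  have hR' : |(N : ℝ) * (βW / (N : ℝ) ^ 2)| / (N : ℝ) * (2 * (((3 : ℕ) : ℝ) - 1)) ≤ Rm := by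
    rw [habs, hRdef]; norm_num
  have hc' : K * Real.exp ε₀ * (1 + 2 * Real.sqrt N * ε₁) * (|(N : ℝ) * (βW / (N : ℝ) ^ 2)| / (N : ℝ)) ≤ c := by
    refine le_trans ?_ hc
    rw [habs]
    have hb : 0 ≤ βW / (N : ℝ) ^ 2 := by positivity
    have h2 : 1 + 2 * Real.sqrt N * ε₁ ≤ 1 + 2 * S * ε₁ := by nlinarith
    have h3 : 0 ≤ 1 + 2 * Real.sqrt N * ε₁ := by positivity
    calc K * Real.exp ε₀ * (1 + 2 * Real.sqrt N * ε₁) * (βW / (N : ℝ) ^ 2)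
        ≤ Kb * E * (1 + 2 * Real.sqrt N * ε₁) * (βW / (N : ℝ) ^ 2) := by gcongr
      _ ≤ Kb * E * (1 + 2 * S * ε₁) * (βW / (N : ℝ) ^ 2) := by gcongr
  have hlam' : Real.sqrt N * ε₁ ≤ lam := le_trans (mul_le_mul_of_nonneg_right hS hε₁) hlam
  have hθ' : θ = (2 * ((3 : ℕ) : ℝ) - 2) * c + lam := by rw [hθ]; push_cast; ring
  have hρ' : ρ = gaugeR 3 c + (lam + θ ^ Kn * (4 * ((3 : ℕ) : ℝ) * lam)) / (1 - θ) := by rw [hρ]; push_cast; ring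
  exact massGapOnBallZdG_of_robustStar (d := 3) (N := N) (by norm_num) hN1 hK0 hR' hmod hε₁ hc' hlam' hθ' hθ1 hcd
    hρ' hρ1

/-! ### `SU(3)`, `d = 3` cells (hypothesis-free, infinite volume) -/

/-- **ROW `(β_W, ε) = (1 / 4, 53 / 500)`, `SU(3)`, `d = 3`, ROBUST STAR DOOR ON `ℤ³`, eigen modulus** (`K₁ = 117/56`;
certificate `c = 24521 / 250000`, `λ = 183599 / 1000000`): `MemBallZdG (53/250) (53/500) R`, 't Hooft coupling `1 / 36`;
HYPOTHESIS-FREE (no H1/H2). [folklore] -/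
theorem su3_massGapOnBallZdG_dim3_star_oneQuarter (R : ℕ) : MassGapOnBallZdG 3 3 (1 / 36) (53 / 250) (53 / 500) R := by
  have e1 : (1 / 4 : ℝ) / ((3 : ℕ) : ℝ) ^ 2 = 1 / 36 := by norm_num
  have hS : Real.sqrt ((3 : ℕ) : ℝ) ≤ 1.73206 := by
    have : ((3 : ℕ) : ℝ) = 3 := by norm_num
    rw [this]; exact sqrt_three_le
  have h := suN_massGapOnBallZdG_dim3_star_eigen 20 (N := 3) (by norm_num) (βW := 1 / 4) (ε₀ := 53 / 250)
    (ε₁ := 53 / 500) (c := 24521 / 250000) (lam := 183599 / 1000000) (E := 1236149 / 1000000) (S := 1.73206) (Kb := 117 / 56)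
    (by norm_num) (by norm_num) (by norm_num) exp_le_53_250_star3 hS (by norm_num) (by norm_num) (by norm_num) (by norm_num)
    (by unfold doorPoly; norm_num) (by unfold gaugeR Delta; norm_num) R
  rw [e1] at h
  exact h

/-- **ROW `(β_W, ε) = (3 / 10, 9 / 125)`, `SU(3)`, `d = 3`, ROBUST STAR DOOR ON `ℤ³`, eigen modulus** (`K₁ = 207/88`;
certificate `c = 5657 / 50000`, `λ = 124709 / 1000000`): 't Hooft coupling `1 / 30`; HYPOTHESIS-FREE. [folklore] -/
theorem su3_massGapOnBallZdG_dim3_star_threeTenths (R : ℕ) : MassGapOnBallZdG 3 3 (1 / 30) (18 / 125) (9 / 125) R := by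
  have e1 : (3 / 10 : ℝ) / ((3 : ℕ) : ℝ) ^ 2 = 1 / 30 := by norm_num
  have hS : Real.sqrt ((3 : ℕ) : ℝ) ≤ 1.73206 := by
    have : ((3 : ℕ) : ℝ) = 3 := by norm_num
    rw [this]; exact sqrt_three_le
  have h := suN_massGapOnBallZdG_dim3_star_eigen 20 (N := 3) (by norm_num) (βW := 3 / 10) (ε₀ := 18 / 125)
    (ε₁ := 9 / 125) (c := 5657 / 50000) (lam := 124709 / 1000000) (E := 230977 / 200000) (S := 1.73206) (Kb := 207 / 88)
    (by norm_num) (by norm_num) (by norm_num) exp_le_18_125_star3 hS (by norm_num) (by norm_num) (by norm_num) (by norm_num)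
    (by unfold doorPoly; norm_num) (by unfold gaugeR Delta; norm_num) R
  rw [e1] at h
  exact h

/-- **ROW `(β_W, ε) = (1 / 3, 1 / 20)`, `SU(3)`, `d = 3`, ROBUST STAR DOOR ON `ℤ³`, eigen modulus** (`K₁ = 387/152`;
certificate `c = 122267 / 1000000`, `λ = 86603 / 1000000`): 't Hooft coupling `1 / 27`; HYPOTHESIS-FREE. [folklore] -/
theorem su3_massGapOnBallZdG_dim3_star_oneThird (R : ℕ) : MassGapOnBallZdG 3 3 (1 / 27) (1 / 10) (1 / 20) R := by
  have e1 : (1 / 3 : ℝ) / ((3 : ℕ) : ℝ) ^ 2 = 1 / 27 := by norm_num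
  have hS : Real.sqrt ((3 : ℕ) : ℝ) ≤ 1.73206 := by
    have : ((3 : ℕ) : ℝ) = 3 := by norm_num
    rw [this]; exact sqrt_three_le
  have h := suN_massGapOnBallZdG_dim3_star_eigen 20 (N := 3) (by norm_num) (βW := 1 / 3) (ε₀ := 1 / 10)
    (ε₁ := 1 / 20) (c := 122267 / 1000000) (lam := 86603 / 1000000) (E := 1105171 / 1000000) (S := 1.73206) (Kb := 387 / 152)
    (by norm_num) (by norm_num) (by norm_num) exp_le_1_10_star hS (by norm_num) (by norm_num) (by norm_num) (by norm_num)
    (by unfold doorPoly; norm_num) (by unfold gaugeR Delta; norm_num) R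
  rw [e1] at h
  exact h

/-! ### Up-to forms of the headline cells (certificates are monotone in the coupling) -/

/-- **`SU(2)`, `d = 3`, UP TO `β_W = 1/2`**: `MassGapOnBallZdG 3 2 (β_W/4) (17/500) (17/1000) R` at every
`0 ≤ β_W ≤ 1/2`. [folklore] -/
theorem su2_massGapOnBallZdG_dim3_star_upTo_oneHalf {βW : ℝ} (h0 : 0 ≤ βW) (h : βW ≤ 1 / 2) (R : ℕ) :
    MassGapOnBallZdG 3 2 (βW / 4) (17 / 500) (17 / 1000) R := by
  refine su2_massGapOnBallZdG_dim3_star 20 (ε₀ := 17 / 500) (ε₁ := 17 / 1000) (c := 67771 / 500000)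
    (lam := 12021 / 500000) (E := 206917 / 200000) (S := 1.41422) h0 (h.trans (by norm_num)) (by norm_num)
    exp_le_17_500_star sqrt_two_le ?_ (by norm_num) (by norm_num) (by unfold doorPoly; norm_num)
    (by unfold gaugeR Delta; norm_num) R
  calc (206917 / 200000 : ℝ) * (1 + 2 * 1.41422 * (17 / 1000)) * (βW / 4)
      ≤ 206917 / 200000 * (1 + 2 * 1.41422 * (17 / 1000)) * ((1 / 2) / 4) := by gcongr
    _ ≤ 67771 / 500000 := by norm_num

/-- **`SU(3)`, `d = 4`, UP TO `β_W = 1/4`** (hypothesis-free): `MassGapOnBallZdG 4 3 (β_W/9) (19/500) (19/1000) R` at every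
`0 ≤ β_W ≤ 1/4` (the eigen modulus at the larger radius `6·(1/4)/9 = 1/6` serves every smaller coupling by the
monotonicity built into `OneLinkKRModulus`'s radius hypothesis of the door). [folklore] -/
theorem su3_massGapOnBallZdG_star_upTo_oneQuarter {βW : ℝ} (h0 : 0 ≤ βW) (h : βW ≤ 1 / 4) (R : ℕ) :
    MassGapOnBallZdG 4 3 (βW / 9) (19 / 500) (19 / 1000) R := by
  -- the door with the modulus at radius `1/6` and the coupling `βW/9 ≤ (1/4)/9`
  have hS : Real.sqrt ((3 : ℕ) : ℝ) ≤ 1.73206 := by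
    have : ((3 : ℕ) : ℝ) = 3 := by norm_num
    rw [this]; exact sqrt_three_le
  have hmod : OneLinkKRModulus 3 ((1 / 4 : ℝ) / ((3 : ℕ) : ℝ) ^ 2 * 6)
      (((3 : ℕ) : ℝ) ^ 2 / (((3 : ℕ) : ℝ) ^ 2 - 1) * ((1 / 2 + 2 * ((1 / 4 : ℝ) / ((3 : ℕ) : ℝ) ^ 2 * 6)) /
        (1 / 2 - (1 / 4 : ℝ) / ((3 : ℕ) : ℝ) ^ 2 * 6))) :=
    OneLinkEigen.oneLinkKRModulus_eigen (N := 3) (by norm_num) (by norm_num)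
  have habs : |((3 : ℕ) : ℝ) * (βW / 9)| / ((3 : ℕ) : ℝ) = βW / 9 := by
    rw [abs_of_nonneg (by positivity)]; push_cast; ring
  refine massGapOnBallZdG_of_robustStar (d := 4) (N := 3) (by norm_num) (by norm_num) (Kn := 20)
    (c := 86493 / 1000000) (lam := 3291 / 100000) (ε₀ := 19 / 500) (by norm_num) ?_ hmod (by norm_num) ?_ ?_ rfl
    (by norm_num) (by unfold doorPoly; norm_num) rfl (by unfold gaugeR Delta; norm_num)
  · rw [habs]; push_cast; linarith
  · rw [habs]
    have hE := exp_le_19_500_star3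
    have hb : 0 ≤ βW / 9 := by positivity
    calc ((3 : ℕ) : ℝ) ^ 2 / (((3 : ℕ) : ℝ) ^ 2 - 1) * ((1 / 2 + 2 * ((1 / 4 : ℝ) / ((3 : ℕ) : ℝ) ^ 2 * 6)) /
          (1 / 2 - (1 / 4 : ℝ) / ((3 : ℕ) : ℝ) ^ 2 * 6)) * Real.exp (19 / 500) *
          (1 + 2 * Real.sqrt ((3 : ℕ) : ℝ) * (19 / 1000)) * (βW / 9)
        ≤ ((3 : ℕ) : ℝ) ^ 2 / (((3 : ℕ) : ℝ) ^ 2 - 1) * ((1 / 2 + 2 * ((1 / 4 : ℝ) / ((3 : ℕ) : ℝ) ^ 2 * 6)) /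
          (1 / 2 - (1 / 4 : ℝ) / ((3 : ℕ) : ℝ) ^ 2 * 6)) * (259683 / 250000) *
          (1 + 2 * 1.73206 * (19 / 1000)) * ((1 / 4) / 9) := by
          gcongr
      _ ≤ 86493 / 1000000 := by push_cast; norm_num
  · have h1 : Real.sqrt ((3 : ℕ) : ℝ) * (19 / 1000) ≤ 1.73206 * (19 / 1000) :=
      mul_le_mul_of_nonneg_right hS (by norm_num)
    linarith

end Summit.Ventures.YMGap.RobustBall

end
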